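import Summits.QuantumFields.BalabanUV.T4Continuum.Support.VariationalColourFederbush
import Summits.QuantumFields.BalabanUV.T4Continuum.Support.VariationalCovariantInterpolant

/-!
# T⁴ programme, spine node NE2 (U1a), lane P2 — SUPPLIER ITEM (O8) «V-COL-ONE», PART 1: THE EXPLICIT COVARIANT ONE-STEP INTERPOLANT FOR
# 0-FORMS WITH VALUES IN A HILBERT SPACE `E` — the colour re-run of leaf ONE⁺ part 1 `VariationalCovariantInterpolant` (leaf-01-g2, p213110)

NE2 formalisation swarm `b2b-balaban-t4-ne2-formalise-*`, leaf prover 02 (gen 4); P2 skeleton `t4/skeletons/NE2-t4-ne2-p2.md` v0.10 §2.E row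
V-COL, member ONE⁺ (§4(g): «the colour version … the same computation with `Tᴴ` for `conj T` … not filed» — part 1 filed here).  Carriers:
`VariationalColourFederbush.{cDv, dirUv, Qcv}` (p214930); weights `VariationalCovariantWeights.{wt, …}` (p212859) and the digit ∕ face lemmas of
`ScalarBlockTrialFunction` BY NAME.
THE COMPETITOR.  For `λ : Tor N → E`: `Λ′(bpt y j) := T′(bpt y j)⋆ Φ(y, j)`, `Φ(y, j) := λ(y) + Σ_ν w_L(j_ν) • (D⁺_ν λ)(y)` (`D⁺ = cDv`), site operators
`T′ x` and coarse bond operators `Rc y μ` UNITARY on `E`, fine bond operators `R′` data.  THE ONE NON-ABELIAN POINT (located before proving):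
the two one-block defects are read IN THE BLOCK FRAMES — in-block `R′(x,μ)∘T′(x+e_μ)⋆ − T′(x)⋆`, crossing `R′(x,μ)∘T′(x+e_μ)⋆ − T′(x)⋆∘Rc(y,μ)`
(operator norm `≤ m`).  For U(1) data these are the scalar leaf's defects times the unit `conj T′(x)`; in general `‖R′∘T′(x′)⋆ − T′(x)⋆‖ =
‖R′∘T′(x′)⋆∘T′(x) − 1‖` (`norm_frameDefect_eq`) but the crossing defect is NOT `R′∘T′(x′)⋆∘T′(x) − Rc` unless `Rc` commutes with `T′(x)`.
In the frame reading the split `R′(T′(x′)⋆g′) − T′(x)⋆g = T′(x)⋆(C g′ − g) + (R′∘T′(x′)⋆ − T′(x)⋆∘C) g′` holds for ANY `C` (`cov_diff_split_frame`).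
 * §1 `Phiv`, `PhiFv`, `interpv`, `hessv`; `sum_update_wt_sub`, exact increments **`Phiv_succ_sub`** (`(1∕L) • D⁺_μλ(y)`) ∕ **`Rc_Phiv_sub`**
   (`+ Σ_ν w_L(j⁰_ν) • (D⁺_μD⁺_νλ)(y)`); §2 `sum_Phiv`, **`Qcv_interpv`** (the transported constraint EXACTLY, `T′T′⋆ = 1`);
 * §3 `cov_diff_split_frame`, `err2v`, **`norm_cDv_interpv_le`** (pointwise bound), `norm_err2v_le`; §4 `norm_Phiv_le`, **`sum_norm_sq_PhiFv_le`**
   (`Σ_x ‖Φ‖² ≤ 2(1+d²)·L^d·Σ_y ‖λ y‖²`).  Part 2 (`VariationalColourOneStep`): the colour cross-term identity `Re Σ_y ⟪G y, (D⁺_μ G)(y)⟫ =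
   −½·Σ_y ‖(D⁺_μ G)(y)‖²` (unitary `Rc`), `norm_frameDefect_eq`, the block sums and the lattice END; part 3: physical units (`rhov`).
HONEST FRAMING (T4-DAG p. 1).  Model level (operators DATA; no group structure; no identification with Bałaban's `U(Γ)`, `Ū`, `U′` — c5);
[folklore] lattice calculus; nothing printed is a hypothesis; no `def … : Prop`; no `sorry`; axioms standard.  ONE block step — no tower (the
composition caveats N-ne2p2g11-2 ∕ G-ne2leaf04g2-1 of the scalar road apply verbatim to any colour tower).  NE2 NOT proved; spine PROVED 0∕9;
rung (B)+1 finite T⁴ — NOT infinite volume, NOT a mass gap, NOT Clay.  HONEST DEPENDENCY (cell, verbatim): continuum YM on T⁴ ⇐ BetaPertH ∧ nine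
spine estimates (0/9 proved); BetaPertH ⇐ (D1) ∧ (D4) ∧ CAP+tail; G-an2-4 gates asym, D1 and NE2/3/4.
-/

noncomputable section

namespace Summit.QuantumFields.BalabanUV.T4Continuum.VariationalColourInterpolant

open Finset
open scoped InnerProductSpace
open Literature.MathematicalPhysics.QuantumFieldTheory.Balaban1983to89
open Literature.MathematicalPhysics.QuantumFieldTheory.Balaban1983to89.B5Prop11Plancherel (Tor fine unitVec)
open Literature.MathematicalPhysics.QuantumFieldTheory.Balaban1983to89.B5Block118 (bpt)
open Literature.MathematicalPhysics.QuantumFieldTheory.Balaban1983to89.B5Blocks16 (blockOf blockOf_bpt)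
open Literature.MathematicalPhysics.QuantumFieldTheory.Balaban1983to89.B5AverageCurlStokes (sum_blocks_real sum_translate)
open Summit.QuantumFields.BalabanUV.T4Continuum.ScalarBlockTrialFunction (digits digits_bpt bpt_add_unitVec_of_lt bpt_add_unitVec_of_eq)
open Summit.QuantumFields.BalabanUV.T4Continuum.VariationalColourFederbush (cDv dirUv Qcv dirUv_nonneg norm_le_one_of_mem_unitary)
open Summit.QuantumFields.BalabanUV.T4Continuum.VariationalCovariantWeights (wt wt_succ_sub one_add_wt_zero_sub abs_wt_le sum_wt_coord)

variable {d : ℕ} {E : Type*} [NormedAddCommGroup E] [InnerProductSpace ℂ E] [CompleteSpace E]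

/-! ## §1 The interpolant in the block frames, the fine competitor, the regularity functional -/

section Objects

variable (L : ℕ) [NeZero L] (N : Fin d → ℕ) [∀ μ, NeZero (N μ)]

/-- the centred forward-Taylor interpolant of `λ` in the frame of the block label `y`, read at the offset `j`:
`Φ(y, j) = λ(y) + Σ_ν w_L(j_ν) • (D⁺_ν λ)(y)`. [folklore] -/
def Phiv (Rc : Tor N → Fin d → (E →L[ℂ] E)) (lam : Tor N → E) (y : Tor N) (j : Fin d → Fin L) : E :=
  lam y + ∑ ν, ((wt L (j ν) : ℝ) : ℂ) • cDv N Rc lam y ν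

/-- the interpolant as a fine field in the block frames: `Φ(block x, digits x)`. [folklore] -/
def PhiFv (Rc : Tor N → Fin d → (E →L[ℂ] E)) (lam : Tor N → E) : Tor (fine L N) → E :=
  fun x => Phiv L N Rc lam (blockOf L N x) (digits L N x)

/-- **THE COMPETITOR**: `Λ′(x) = T′(x)⋆ Φ(block x, digits x)` — the interpolant carried to the fine sites by the adjoint site operators. [folklore] -/
def interpv (T' : Tor (fine L N) → (E →L[ℂ] E)) (Rc : Tor N → Fin d → (E →L[ℂ] E)) (lam : Tor N → E) : Tor (fine L N) → E :=
  fun x => star (T' x) (PhiFv L N Rc lam x)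

/-- the FULL FORWARD COVARIANT HESSIAN (lattice units): `hessv λ = Σ_μ Σ_ν Σ_y ‖(D⁺_μ (D⁺_ν λ))(y)‖²`. [folklore] -/
def hessv (Rc : Tor N → Fin d → (E →L[ℂ] E)) (lam : Tor N → E) : ℝ := ∑ μ, ∑ ν, dirUv N Rc (fun z => cDv N Rc lam z ν) μ

omit [CompleteSpace E] in
/-- the Hessian functional is nonnegative. [folklore] -/
theorem hessv_nonneg (Rc : Tor N → Fin d → (E →L[ℂ] E)) (lam : Tor N → E) : 0 ≤ hessv N Rc lam :=
  sum_nonneg fun _ _ => sum_nonneg fun _ _ => dirUv_nonneg _ _ _ _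

omit [CompleteSpace E] in
/-- `Φ` read at a block point. [folklore] -/
theorem PhiFv_bpt (Rc : Tor N → Fin d → (E →L[ℂ] E)) (lam : Tor N → E) (y : Tor N) (j : Fin d → Fin L) :
    PhiFv L N Rc lam (bpt L N y j) = Phiv L N Rc lam y j := by
  rw [PhiFv, blockOf_bpt, digits_bpt]

/-- `Λ′` read at a block point. [folklore] -/
theorem interpv_bpt (T' : Tor (fine L N) → (E →L[ℂ] E)) (Rc : Tor N → Fin d → (E →L[ℂ] E)) (lam : Tor N → E) (y : Tor N)
    (j : Fin d → Fin L) : interpv L N T' Rc lam (bpt L N y j) = star (T' (bpt L N y j)) (Phiv L N Rc lam y j) := by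
  rw [interpv, PhiFv_bpt]

variable (Rc : Tor N → Fin d → (E →L[ℂ] E)) (lam : Tor N → E)

omit [NeZero L] [∀ μ, NeZero (N μ)] [CompleteSpace E] in
/-- moving one offset digit changes exactly one weight: `Σ_ν w(j[μ↦a]_ν)•X_ν − Σ_ν w(j_ν)•X_ν = (w(a) − w(j_μ))•X_μ`. [folklore] -/
theorem sum_update_wt_sub (X : Fin d → E) (j : Fin d → Fin L) (μ : Fin d) (a : Fin L) :
    ∑ ν, ((wt L (Function.update j μ a ν) : ℝ) : ℂ) • X ν - ∑ ν, ((wt L (j ν) : ℝ) : ℂ) • X ν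
      = (((wt L a - wt L (j μ)) : ℝ) : ℂ) • X μ := by
  classical
  rw [← Finset.sum_sub_distrib]
  have h : ∀ ν, ((wt L (Function.update j μ a ν) : ℝ) : ℂ) • X ν - ((wt L (j ν) : ℝ) : ℂ) • X ν
      = if ν = μ then (((wt L a - wt L (j μ)) : ℝ) : ℂ) • X μ else 0 := by
    intro ν
    by_cases hν : ν = μ
    · subst hν; rw [Function.update_self, if_pos rfl, ← sub_smul]; push_cast; rfl
    · rw [Function.update_of_ne hν, if_neg hν, sub_self]
  rw [Finset.sum_congr rfl fun ν _ => h ν, Finset.sum_ite_eq' Finset.univ μ, if_pos (Finset.mem_univ μ)]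

omit [∀ μ, NeZero (N μ)] [CompleteSpace E] in
/-- **IN-BLOCK INCREMENT, EXACT**: `Φ(y, j[μ ↦ j_μ+1]) − Φ(y, j) = (1∕L) • (D⁺_μ λ)(y)`. [folklore] -/
theorem Phiv_succ_sub (y : Tor N) (j : Fin d → Fin L) (μ : Fin d) (h : (j μ : ℕ) + 1 < L) :
    Phiv L N Rc lam y (Function.update j μ ⟨(j μ : ℕ) + 1, h⟩) - Phiv L N Rc lam y j = ((L : ℂ))⁻¹ • cDv N Rc lam y μ := by
  unfold Phiv
  rw [add_sub_add_left_eq_sub, sum_update_wt_sub L (fun ν => cDv N Rc lam y ν) j μ ⟨(j μ : ℕ) + 1, h⟩]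
  have hw : wt L ((⟨(j μ : ℕ) + 1, h⟩ : Fin L) : ℕ) - wt L (j μ) = 1 / L := wt_succ_sub L (j μ)
  rw [hw]
  push_cast
  rw [one_div]

omit [∀ μ, NeZero (N μ)] [CompleteSpace E] in
/-- `Rc(y,μ)((D⁺_ν λ)(y+e_μ)) = (D⁺_μ D⁺_ν λ)(y) + (D⁺_ν λ)(y)` — the definition of the second covariant difference, rearranged. [folklore] -/
theorem Rc_cDv_shift (y : Tor N) (μ ν : Fin d) :
    Rc y μ (cDv N Rc lam (y + unitVec N μ) ν) = cDv N Rc (fun z => cDv N Rc lam z ν) y μ + cDv N Rc lam y ν := by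
  simp only [cDv]; abel

omit [∀ μ, NeZero (N μ)] [CompleteSpace E] in
/-- **BLOCK-CROSSING INCREMENT, EXACT** (frame `y`; `j_μ = L−1`, `j⁰ = j[μ ↦ 0]`):
`Rc(y,μ)(Φ(y+e_μ, j⁰)) − Φ(y, j) = (1∕L) • (D⁺_μλ)(y) + Σ_ν w_L(j⁰_ν) • (D⁺_μ D⁺_ν λ)(y)` — a second covariant difference. [folklore] -/
theorem Rc_Phiv_sub (y : Tor N) (j : Fin d → Fin L) (μ : Fin d) (h : (j μ : ℕ) + 1 = L) :
    Rc y μ (Phiv L N Rc lam (y + unitVec N μ) (Function.update j μ 0)) - Phiv L N Rc lam y j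
      = ((L : ℂ))⁻¹ • cDv N Rc lam y μ
        + ∑ ν, ((wt L (Function.update j μ (0 : Fin L) ν) : ℝ) : ℂ) • cDv N Rc (fun z => cDv N Rc lam z ν) y μ := by
  have hsw := sum_update_wt_sub L (fun ν => cDv N Rc lam y ν) j μ 0
  have hw : 1 + (wt L ((0 : Fin L) : ℕ) - wt L (j μ)) = 1 / L := by
    rw [Fin.val_zero]; exact one_add_wt_zero_sub L (j μ) h
  have hw' : (1 : ℂ) + (((wt L ((0 : Fin L) : ℕ) - wt L (j μ)) : ℝ) : ℂ) = ((L : ℂ))⁻¹ := by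
    have := congrArg (fun r : ℝ => (r : ℂ)) hw
    push_cast at this
    push_cast
    rw [this, one_div]
  -- expand `Rc (Φ(y+e_μ, j⁰))` by linearity and `Rc_cDv_shift`
  have hexp : Rc y μ (Phiv L N Rc lam (y + unitVec N μ) (Function.update j μ 0))
      = (cDv N Rc lam y μ + lam y)
        + (∑ ν, ((wt L (Function.update j μ (0 : Fin L) ν) : ℝ) : ℂ) • cDv N Rc (fun z => cDv N Rc lam z ν) y μ
          + ∑ ν, ((wt L (Function.update j μ (0 : Fin L) ν) : ℝ) : ℂ) • cDv N Rc lam y ν) := by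
    unfold Phiv
    rw [map_add, map_sum, ← Finset.sum_add_distrib]
    congr 1
    · simp only [cDv]; abel
    · refine Finset.sum_congr rfl fun ν _ => ?_
      rw [map_smul, Rc_cDv_shift, smul_add]
  -- the weight sum against `D λ(y)`: `Σ_ν w(j⁰_ν)•Dλ_ν = Σ_ν w(j_ν)•Dλ_ν + (w(0) − w(j_μ))•Dλ_μ`
  have hsw' : ∑ ν, ((wt L (Function.update j μ (0 : Fin L) ν) : ℝ) : ℂ) • cDv N Rc lam y ν
      = ∑ ν, ((wt L (j ν) : ℝ) : ℂ) • cDv N Rc lam y ν + (((wt L ((0 : Fin L) : ℕ) - wt L (j μ)) : ℝ) : ℂ) • cDv N Rc lam y μ := by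
    rw [← hsw]; abel
  rw [hexp, hsw']
  unfold Phiv
  -- collect: `Dλ_μ + (w0 − w)•Dλ_μ = (1 + (w0 − w))•Dλ_μ = L⁻¹•Dλ_μ`
  have hcollect : cDv N Rc lam y μ + (((wt L ((0 : Fin L) : ℕ) - wt L (j μ)) : ℝ) : ℂ) • cDv N Rc lam y μ = ((L : ℂ))⁻¹ • cDv N Rc lam y μ := by
    rw [← hw', add_smul, one_smul]
  rw [← hcollect]
  abel

end Objects

/-! ## §2 The transported constraint holds EXACTLY -/

section Constraint

variable (L : ℕ) [NeZero L] (N : Fin d → ℕ) [∀ μ, NeZero (N μ)] (Rc : Tor N → Fin d → (E →L[ℂ] E)) (lam : Tor N → E)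

omit [NeZero L] [∀ μ, NeZero (N μ)] [CompleteSpace E] in
/-- block sums of the interpolant: `Σ_j Φ(y, j) = L^d • λ(y)` (the weights are centred in every coordinate). [folklore] -/
theorem sum_Phiv (y : Tor N) : ∑ j : Fin d → Fin L, Phiv L N Rc lam y j = ((L : ℂ) ^ d) • lam y := by
  have hcard : (Finset.univ : Finset (Fin d → Fin L)).card = L ^ d := by
    rw [Finset.card_univ, Fintype.card_fun, Fintype.card_fin, Fintype.card_fin]
  unfold Phiv
  rw [Finset.sum_add_distrib, Finset.sum_const, hcard, Finset.sum_comm]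
  have h0 : ∀ ν : Fin d, ∑ j : Fin d → Fin L, ((wt L (j ν) : ℝ) : ℂ) • cDv N Rc lam y ν = 0 := by
    intro ν
    rw [← Finset.sum_smul, ← Complex.ofReal_sum, sum_wt_coord L ν, Complex.ofReal_zero, zero_smul]
  rw [Finset.sum_congr rfl fun ν _ => h0 ν, Finset.sum_const_zero, add_zero, ← Nat.cast_pow, Nat.cast_smul_eq_nsmul]

/-- **CONSTRAINT, EXACTLY**: `Qcv L N T′ Λ′ = λ` for unitary one-step site operators (`T′ T′⋆ = 1`, then `sum_Phiv`). [folklore] -/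
theorem Qcv_interpv {T' : Tor (fine L N) → (E →L[ℂ] E)} (hT1 : ∀ x, T' x ∈ unitary (E →L[ℂ] E)) :
    (fun y => Qcv L N T' (interpv L N T' Rc lam) y) = lam := by
  funext y
  have hL : ((L : ℂ) ^ d) ≠ 0 := pow_ne_zero _ (by exact_mod_cast NeZero.ne L)
  unfold Qcv
  have hTT : ∀ (x : Tor (fine L N)) (v : E), T' x (star (T' x) v) = v := fun x v => by
    have h := congrArg (fun S : E →L[ℂ] E => S v) (Unitary.mem_iff.mp (hT1 x)).2
    simpa only [mul_apply_eq_comp, one_apply_eq_self] using h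
  have hj : ∀ j : Fin d → Fin L, T' (bpt L N y j) (interpv L N T' Rc lam (bpt L N y j)) = Phiv L N Rc lam y j := by
    intro j
    rw [interpv_bpt, hTT]
  simp_rw [hj]
  rw [sum_Phiv, smul_smul, inv_mul_cancel₀ hL, one_smul]

end Constraint

/-! ## §3 The fine covariant differences of the competitor: the frame split and the pointwise bound -/

section Bonds

variable (L : ℕ) [NeZero L] (N : Fin d → ℕ) [∀ μ, NeZero (N μ)]

omit [NeZero L] [∀ μ, NeZero (N μ)] [CompleteSpace E] in
/-- **THE FRAME SPLIT** (any `C`; `C = 1` in the block, `C = Rc(y,μ)` across a face; no unitarity, no commutativity):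
`R′(T′(x′)⋆ g′) − T′(x)⋆ g = T′(x)⋆ (C g′ − g) + (R′ ∘ T′(x′)⋆ − T′(x)⋆ ∘ C) g′`. [folklore] -/
theorem cov_diff_split_frame (R' C Sx Sx' : E →L[ℂ] E) (g g' : E) :
    R' (Sx' g') - Sx g = Sx (C g' - g) + (R' * Sx' - Sx * C) g' := by
  simp only [sub_apply, mul_apply_eq_comp, map_sub]
  abel

variable (Rc : Tor N → Fin d → (E →L[ℂ] E)) (lam : Tor N → E)

/-- the SECOND-ORDER part of the frame increment on a bond: zero in the block, `Σ_ν w_L(j⁰_ν) • (D⁺_μD⁺_νλ)(y)` across a face. [folklore] -/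
def err2v (y : Tor N) (j : Fin d → Fin L) (μ : Fin d) : E :=
  if (j μ : ℕ) + 1 = L then ∑ ν, ((wt L (Function.update j μ (0 : Fin L) ν) : ℝ) : ℂ) • cDv N Rc (fun z => cDv N Rc lam z ν) y μ else 0

/-- `‖T⋆ v‖ ≤ ‖v‖` for unitary `T`. [folklore] -/
theorem norm_star_apply_le {T : E →L[ℂ] E} (hT : T ∈ unitary (E →L[ℂ] E)) (v : E) : ‖star T v‖ ≤ ‖v‖ := by
  have hs : ‖star T‖ ≤ 1 := by rw [norm_star]; exact norm_le_one_of_mem_unitary hT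
  exact (ContinuousLinearMap.le_opNorm _ _).trans (mul_le_of_le_one_left (norm_nonneg _) hs)

/-- **POINTWISE BOUND** at `x = bpt y j`, direction `μ`, under unitary site operators and the two FRAME defects `≤ m`
(in-block `‖R′(x,μ)∘T′(x+e_μ)⋆ − T′(x)⋆‖ ≤ m`, crossing `‖R′(x,μ)∘T′(x+e_μ)⋆ − T′(x)⋆∘Rc(y,μ)‖ ≤ m`):
`‖R′(x,μ)Λ′(x+e_μ) − Λ′(x)‖ ≤ ‖(1∕L)•(D⁺_μλ)(y) + err₂(y,j,μ)‖ + m·‖Φ(block(x+e_μ), digits(x+e_μ))‖`. [folklore] -/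
theorem norm_cDv_interpv_le {T' : Tor (fine L N) → (E →L[ℂ] E)} (hT1 : ∀ x, T' x ∈ unitary (E →L[ℂ] E))
    {R' : Tor (fine L N) → Fin d → (E →L[ℂ] E)} {m : ℝ}
    (hin : ∀ (y : Tor N) (j : Fin d → Fin L) (μ : Fin d), (j μ : ℕ) + 1 < L →
      ‖R' (bpt L N y j) μ * star (T' (bpt L N y j + unitVec (fine L N) μ)) - star (T' (bpt L N y j))‖ ≤ m)
    (hcross : ∀ (y : Tor N) (j : Fin d → Fin L) (μ : Fin d), (j μ : ℕ) + 1 = L →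
      ‖R' (bpt L N y j) μ * star (T' (bpt L N y j + unitVec (fine L N) μ)) - star (T' (bpt L N y j)) * Rc y μ‖ ≤ m)
    (y : Tor N) (j : Fin d → Fin L) (μ : Fin d) :
    ‖cDv (fine L N) R' (interpv L N T' Rc lam) (bpt L N y j) μ‖
      ≤ ‖((L : ℂ))⁻¹ • cDv N Rc lam y μ + err2v L N Rc lam y j μ‖
        + m * ‖PhiFv L N Rc lam (bpt L N y j + unitVec (fine L N) μ)‖ := by
  set x := bpt L N y j with hx
  set x' := bpt L N y j + unitVec (fine L N) μ with hx'
  have hcD : cDv (fine L N) R' (interpv L N T' Rc lam) x μ = R' x μ (star (T' x') (PhiFv L N Rc lam x')) - star (T' x) (PhiFv L N Rc lam x) :=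
    rfl
  by_cases hlt : (j μ : ℕ) + 1 < L
  · -- IN-BLOCK bond: increment `(1∕L)•D_μλ(y)`, frame defect ≤ m, no second-order part
    have hne : ¬ ((j μ : ℕ) + 1 = L) := by omega
    have hgx : PhiFv L N Rc lam x = Phiv L N Rc lam y j := PhiFv_bpt L N Rc lam y j
    have hgx' : PhiFv L N Rc lam x' = Phiv L N Rc lam y (Function.update j μ ⟨(j μ : ℕ) + 1, hlt⟩) := by
      rw [hx', bpt_add_unitVec_of_lt L N y j μ hlt, PhiFv_bpt]
    rw [err2v, if_neg hne, add_zero, hcD, cov_diff_split_frame (R' x μ) 1 (star (T' x)) (star (T' x')), mul_one, one_apply_eq_self]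
    refine (norm_add_le _ _).trans (add_le_add ?_ ?_)
    · refine (norm_star_apply_le (hT1 x) _).trans (le_of_eq ?_)
      rw [hgx, hgx', Phiv_succ_sub L N Rc lam y j μ hlt]
    · exact (ContinuousLinearMap.le_opNorm _ _).trans (mul_le_mul_of_nonneg_right (hin y j μ hlt) (norm_nonneg _))
  · -- CROSSING bond: increment `(1∕L)•D_μλ(y) + err₂`, frame mismatch ≤ m
    have heq : (j μ : ℕ) + 1 = L := by have := (j μ).is_lt; omega
    have hgx : PhiFv L N Rc lam x = Phiv L N Rc lam y j := PhiFv_bpt L N Rc lam y j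
    have hgx' : PhiFv L N Rc lam x' = Phiv L N Rc lam (y + unitVec N μ) (Function.update j μ 0) := by
      rw [hx', bpt_add_unitVec_of_eq L N y j μ heq, PhiFv_bpt]
    rw [err2v, if_pos heq, hcD, cov_diff_split_frame (R' x μ) (Rc y μ) (star (T' x)) (star (T' x'))]
    refine (norm_add_le _ _).trans (add_le_add ?_ ?_)
    · refine (norm_star_apply_le (hT1 x) _).trans (le_of_eq ?_)
      rw [hgx, hgx', Rc_Phiv_sub L N Rc lam y j μ heq]
    · exact (ContinuousLinearMap.le_opNorm _ _).trans (mul_le_mul_of_nonneg_right (hcross y j μ heq) (norm_nonneg _))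

omit [∀ μ, NeZero (N μ)] [CompleteSpace E] in
/-- the second-order part is bounded by half the sum of the second covariant differences: `‖err₂(y,j,μ)‖ ≤ ½Σ_ν ‖(D⁺_μD⁺_νλ)(y)‖`,
and vanishes off the far face. [folklore] -/
theorem norm_err2v_le (y : Tor N) (j : Fin d → Fin L) (μ : Fin d) :
    ‖err2v L N Rc lam y j μ‖
      ≤ (if (j μ : ℕ) + 1 = L then (1 : ℝ) else 0) * ((1 / 2) * ∑ ν, ‖cDv N Rc (fun z => cDv N Rc lam z ν) y μ‖) := by
  unfold err2v
  split_ifs with h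
  · rw [one_mul, Finset.mul_sum]
    refine (norm_sum_le _ _).trans (Finset.sum_le_sum fun ν _ => ?_)
    rw [norm_smul, Complex.norm_real, Real.norm_eq_abs]
    exact mul_le_mul_of_nonneg_right (abs_wt_le L (Function.update j μ (0 : Fin L) ν).is_lt) (norm_nonneg _)
  · simp

end Bonds

/-! ## §4 The size of the interpolant -/

section Size

variable (L : ℕ) [NeZero L] (N : Fin d → ℕ) [∀ μ, NeZero (N μ)] (Rc : Tor N → Fin d → (E →L[ℂ] E)) (lam : Tor N → E)

omit [NeZero L] [∀ μ, NeZero (N μ)] [CompleteSpace E] in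
/-- `‖Φ(y,j)‖ ≤ ‖λ(y)‖ + ½Σ_ν(‖λ(y+e_ν)‖ + ‖λ(y)‖)` for contractive coarse operators. [folklore] -/
theorem norm_Phiv_le (hRc : ∀ y μ, ‖Rc y μ‖ ≤ 1) (y : Tor N) (j : Fin d → Fin L) :
    ‖Phiv L N Rc lam y j‖ ≤ ‖lam y‖ + (1 / 2) * ∑ ν, (‖lam (y + unitVec N ν)‖ + ‖lam y‖) := by
  unfold Phiv
  refine (norm_add_le _ _).trans (add_le_add le_rfl ?_)
  rw [Finset.mul_sum]
  refine (norm_sum_le _ _).trans (Finset.sum_le_sum fun ν _ => ?_)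
  rw [norm_smul, Complex.norm_real, Real.norm_eq_abs]
  have hD : ‖cDv N Rc lam y ν‖ ≤ ‖lam (y + unitVec N ν)‖ + ‖lam y‖ := by
    unfold cDv
    refine (norm_sub_le _ _).trans (add_le_add ?_ le_rfl)
    exact (ContinuousLinearMap.le_opNorm _ _).trans (mul_le_of_le_one_left (norm_nonneg _) (hRc y ν))
  exact mul_le_mul (abs_wt_le L (j ν).is_lt) hD (norm_nonneg _) (by norm_num)

omit [CompleteSpace E] in
/-- **SIZE OF THE INTERPOLANT**: `Σ_x ‖Φ(block x, digits x)‖² ≤ 2(1 + d²)·L^d·Σ_y ‖λ(y)‖²` — the scalar leaf's count BY NAME on the real field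
`y ↦ ‖λ y‖`-majorant (zero phases make `cD 0 g y ν = −g y`, so the scalar `Φ` of `‖λ‖` dominates pointwise). [folklore] -/
theorem sum_norm_sq_PhiFv_le (hRc : ∀ y μ, ‖Rc y μ‖ ≤ 1) :
    ∑ x, ‖PhiFv L N Rc lam x‖ ^ 2 ≤ 2 * (1 + (d : ℝ) ^ 2) * ((L : ℝ) ^ d * ∑ y, ‖lam y‖ ^ 2) := by
  have hshift : ∀ ν : Fin d, ∑ y : Tor N, ‖lam (y + unitVec N ν)‖ ^ 2 = ∑ y, ‖lam y‖ ^ 2 := fun ν =>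
    Fintype.sum_equiv (Equiv.addRight (unitVec N ν)) _ _ fun y => rfl
  have hpt : ∀ (y : Tor N) (j : Fin d → Fin L),
      ‖Phiv L N Rc lam y j‖ ^ 2 ≤ 2 * ‖lam y‖ ^ 2 + d * ∑ ν, (‖lam (y + unitVec N ν)‖ ^ 2 + ‖lam y‖ ^ 2) := by
    intro y j
    set a : ℝ := ‖lam y‖ with ha
    set b : Fin d → ℝ := fun ν => ‖lam (y + unitVec N ν)‖ + ‖lam y‖ with hb
    have h1 : ‖Phiv L N Rc lam y j‖ ≤ a + (1 / 2) * ∑ ν, b ν := norm_Phiv_le L N Rc lam hRc y j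
    have h2 := pow_le_pow_left₀ (norm_nonneg _) h1 2
    have hcs : (∑ ν, b ν) ^ 2 ≤ d * ∑ ν, b ν ^ 2 := by
      have h := VariationalCovariantFederbush.sq_sum_le_card_mul (Finset.univ : Finset (Fin d)) b
      rwa [Finset.card_univ, Fintype.card_fin] at h
    have hb2 : ∀ ν, b ν ^ 2 ≤ 2 * (‖lam (y + unitVec N ν)‖ ^ 2 + ‖lam y‖ ^ 2) := fun ν => by
      simp only [hb]; nlinarith [sq_nonneg (‖lam (y + unitVec N ν)‖ - ‖lam y‖)]
    have hsum : ∑ ν, b ν ^ 2 ≤ 2 * ∑ ν, (‖lam (y + unitVec N ν)‖ ^ 2 + ‖lam y‖ ^ 2) := by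
      rw [Finset.mul_sum]; exact Finset.sum_le_sum fun ν _ => hb2 ν
    have hd : (0 : ℝ) ≤ d := Nat.cast_nonneg d
    nlinarith [h2, hcs, hsum, sq_nonneg (a - (1 / 2) * ∑ ν, b ν), mul_le_mul_of_nonneg_left hsum hd]
  have hcardR : (Fintype.card (Fin d → Fin L) : ℝ) = (L : ℝ) ^ d := by
    rw [Fintype.card_fun, Fintype.card_fin, Fintype.card_fin]; push_cast; ring
  have hS : ∑ y : Tor N, ∑ ν : Fin d, (‖lam (y + unitVec N ν)‖ ^ 2 + ‖lam y‖ ^ 2) = 2 * d * ∑ y, ‖lam y‖ ^ 2 := by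
    rw [Finset.sum_comm]
    have h1 : ∀ ν : Fin d, ∑ y : Tor N, (‖lam (y + unitVec N ν)‖ ^ 2 + ‖lam y‖ ^ 2) = 2 * ∑ y, ‖lam y‖ ^ 2 := by
      intro ν; rw [Finset.sum_add_distrib, hshift ν]; ring
    rw [Finset.sum_congr rfl fun ν _ => h1 ν, Finset.sum_const, Finset.card_univ, Fintype.card_fin, nsmul_eq_mul]
    ring
  have hY : ∑ y : Tor N, 2 * ‖lam y‖ ^ 2 = 2 * ∑ y, ‖lam y‖ ^ 2 := by rw [Finset.mul_sum]
  rw [sum_blocks_real L N (fun x => ‖PhiFv L N Rc lam x‖ ^ 2)]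
  simp only [PhiFv_bpt]
  calc ∑ y : Tor N, ∑ j : Fin d → Fin L, ‖Phiv L N Rc lam y j‖ ^ 2
      ≤ ∑ y : Tor N, ∑ _j : Fin d → Fin L, (2 * ‖lam y‖ ^ 2 + d * ∑ ν, (‖lam (y + unitVec N ν)‖ ^ 2 + ‖lam y‖ ^ 2)) :=
        Finset.sum_le_sum fun y _ => Finset.sum_le_sum fun j _ => hpt y j
    _ = ∑ y : Tor N, (Fintype.card (Fin d → Fin L) : ℝ) * (2 * ‖lam y‖ ^ 2 + d * ∑ ν, (‖lam (y + unitVec N ν)‖ ^ 2 + ‖lam y‖ ^ 2)) := by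
        refine Finset.sum_congr rfl fun y _ => ?_
        rw [Finset.sum_const, Finset.card_univ, nsmul_eq_mul]
    _ = (Fintype.card (Fin d → Fin L) : ℝ) * (2 * ∑ y, ‖lam y‖ ^ 2 + d * (2 * d * ∑ y, ‖lam y‖ ^ 2)) := by
        rw [← Finset.mul_sum, Finset.sum_add_distrib, hY, ← Finset.mul_sum, hS]
    _ = 2 * (1 + (d : ℝ) ^ 2) * ((L : ℝ) ^ d * ∑ y : Tor N, ‖lam y‖ ^ 2) := by
        rw [hcardR]; ring

end Size

end Summit.QuantumFields.BalabanUV.T4Continuum.VariationalColourInterpolant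

end
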